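import Summits.CriticalPhenomena.PercolationContinuityZ3.Theorems.PercNearOneGluingNoHeavyLowerTailTwoPortPeelingLevelTwoTranslate
import Summits.CriticalPhenomena.PercolationContinuityZ3.Theorems.PercNearOneGluingNoHeavyLowerTailTwoPortPeelingRelayOrder
import HarnessLib

/-!
# `NoHeavyLowerTail` (stmt-CriticalPhenomena-4575) — two-port peeling, champion at a port: level-2 translations of the pendant worlds

Route `PercNearOneGluingNoHeavy`, seat `prim-gen-swap` (gen 5); memo TWO-PORT-PEELING.md §9 (T).  For the champion-at-a-port
case (`u = {c, a'}`, `v = {b, b'}`) the CS₂ pair events `ρ(u,v;c)`, `ℓ(u,v;c)` must be read in the worlds where `u` is a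
pendant vertex at `a'` (bond `ua'` open, `uc` closed) with `v` closed (`P0`) or glued (`PV`).  `iffs_cport_pendant` gives the
four membership translations at a configuration in which both hubs are isolated:
`ρ@P0 ↔ ¬(c∼a') ∧ c lonely`, `ℓ@P0 ↔ ¬(c∼a') ∧ a' lonely`, `ρ@PV ↔ ¬(c∼a') ∧ ¬(c∼b) ∧ ¬(c∼b') ∧ c lonely`, `ℓ@PV ↔ False`
(`j ≤ 2`).  No definitions, no named facts, no sorries.
-/

noncomputable section

namespace Summit.CriticalPhenomena.PercolationContinuityZ3.Theorems

open MeasureTheory Set Literature.Probability.LatticeModels Literature.Probability.Percolation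
open scoped Classical BigOperators

variable {n : ℕ}

namespace TwoPortPeeling

/-- Reaching the centre of a pendant vertex `u` (only bond `ua'`, `u` otherwise isolated) from `x ≠ u` means reaching `a'`.
[this file] -/
theorem reachable_pendant_center_iff (ω : BondConfig (Fin n)) {u a' : Fin n} (hua' : u ≠ a')
    (hiso : ∀ y : Fin n, y ≠ u → s(u, y) ∉ ω) {x : Fin n} (hx : x ≠ u) :
    (openGraph (insert s(u, a') ω)).Reachable x u ↔ (openGraph ω).Reachable x a' := by
  have h := reachable_hub_center_iff ω hua' hua' hiso hx
  rw [Set.insert_eq_of_mem (Set.mem_insert _ _), or_self] at h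
  exact h

/-- A pendant bond at `u` leaves another isolated vertex `v ∉ {u, a'}` isolated. [this file] -/
theorem isolated_insert_pendant (ω : BondConfig (Fin n)) {u v a' : Fin n} (hvu : v ≠ u) (hva' : v ≠ a')
    (hiso : ∀ y : Fin n, y ≠ v → s(v, y) ∉ ω) :
    ∀ y : Fin n, y ≠ v → s(v, y) ∉ insert s(u, a') ω := by
  intro y hyv h
  rcases Set.mem_insert_iff.1 h with h | h
  · rw [Sym2.eq_iff] at h
    rcases h with ⟨h1, _⟩ | ⟨h1, _⟩
    · exact hvu h1
    · exact hva' h1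
  · exact hiso y hyv h

/-- **Level-2 translations, pendant worlds (champion at a port).**  Hubs `u, v ∉ A` isolated in `ω`; `u`'s ports `c, a'`,
`v`'s ports `b, b'` (all in `A`, pairwise distinct), `j ≤ 2`.  Memberships of `ω` in the pullbacks of the CS₂ pair events
`ρ(u,v;c) = {c ∉ π(u), c ∉ π(v), c lonely}` and `ℓ(u,v;c) = {c ∉ π(u), c ∉ π(v), 1 ≤ |π(u) ∪ π(v)| ≤ j}` along
`ω ↦ ω + ua'` (world `P0`) and `ω ↦ ω + ua' + vb + vb'` (world `PV`). [this file; memo §9 (T)] -/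
theorem iffs_cport_pendant (A : Finset (Fin n)) (ω : BondConfig (Fin n))
    (u v c a' b b' : Fin n) (j : ℕ) (hj : j ≤ 2) (hu : u ∉ A) (hv : v ∉ A) (huv : u ≠ v)
    (hc : c ∈ A) (ha' : a' ∈ A) (hb : b ∈ A) (hb' : b' ∈ A)
    (hcb : c ≠ b) (hcb' : c ≠ b') (ha'b : a' ≠ b) (ha'b' : a' ≠ b') (hbb' : b ≠ b')
    (hisoU : ∀ y : Fin n, y ≠ u → s(u, y) ∉ ω) (hisoV : ∀ y : Fin n, y ≠ v → s(v, y) ∉ ω) :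
    (ω ∈ (fun ω : BondConfig (Fin n) => insert s(u, a') ω) ⁻¹'
        {ω : BondConfig (Fin n) | ω ∉ openConn c u ∧ ω ∉ openConn c v ∧ (A.filter fun z => ω ∈ openConn c z).card ≤ j} ↔
      (¬ (openGraph ω).Reachable c a' ∧ (A.filter fun z => ω ∈ openConn c z).card ≤ j)) ∧
    (ω ∈ (fun ω : BondConfig (Fin n) => insert s(u, a') ω) ⁻¹'
        {ω : BondConfig (Fin n) | ω ∉ openConn c u ∧ ω ∉ openConn c v ∧
          1 ≤ (A.filter fun z => ω ∈ openConn u z ∨ ω ∈ openConn v z).card ∧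
          (A.filter fun z => ω ∈ openConn u z ∨ ω ∈ openConn v z).card ≤ j} ↔
      (¬ (openGraph ω).Reachable c a' ∧ (A.filter fun z => ω ∈ openConn a' z).card ≤ j)) ∧
    (ω ∈ (fun ω : BondConfig (Fin n) => insert s(u, a') (insert s(v, b) (insert s(v, b') ω))) ⁻¹'
        {ω : BondConfig (Fin n) | ω ∉ openConn c u ∧ ω ∉ openConn c v ∧ (A.filter fun z => ω ∈ openConn c z).card ≤ j} ↔
      (¬ (openGraph ω).Reachable c a' ∧ ¬ (openGraph ω).Reachable c b ∧ ¬ (openGraph ω).Reachable c b' ∧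
        (A.filter fun z => ω ∈ openConn c z).card ≤ j)) ∧
    (ω ∈ (fun ω : BondConfig (Fin n) => insert s(u, a') (insert s(v, b) (insert s(v, b') ω))) ⁻¹'
        {ω : BondConfig (Fin n) | ω ∉ openConn c u ∧ ω ∉ openConn c v ∧
          1 ≤ (A.filter fun z => ω ∈ openConn u z ∨ ω ∈ openConn v z).card ∧
          (A.filter fun z => ω ∈ openConn u z ∨ ω ∈ openConn v z).card ≤ j} ↔ False) := by
  have hua' : u ≠ a' := fun h => hu (h ▸ ha')
  have huc : u ≠ c := fun h => hu (h ▸ hc)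
  have hub : u ≠ b := fun h => hu (h ▸ hb)
  have hub' : u ≠ b' := fun h => hu (h ▸ hb')
  have hva' : v ≠ a' := fun h => hv (h ▸ ha')
  have hvc : v ≠ c := fun h => hv (h ▸ hc)
  have hvb : v ≠ b := fun h => hv (h ▸ hb)
  have hvb' : v ≠ b' := fun h => hv (h ▸ hb')
  -- world P0
  set ω₁ : BondConfig (Fin n) := insert s(u, a') ω with hω₁
  have pend : ∀ {p q : Fin n}, p ≠ u → q ≠ u → ((openGraph ω₁).Reachable p q ↔ (openGraph ω).Reachable p q) :=
    fun hp hq => reachable_pendant_iff ω hua' hisoU hp hq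
  have ctr : ∀ {x : Fin n}, x ≠ u → ((openGraph ω₁).Reachable x u ↔ (openGraph ω).Reachable x a') :=
    fun hx => reachable_pendant_center_iff ω hua' hisoU hx
  have hisoV₁ : ∀ y : Fin n, y ≠ v → s(v, y) ∉ ω₁ := isolated_insert_pendant ω huv.symm hva' hisoV
  have hcv1 : ¬ (openGraph ω₁).Reachable c v := not_reachable_to_isolated ω₁ hvc.symm hisoV₁
  have hfc1 : (A.filter fun z => ω₁ ∈ openConn c z) = (A.filter fun z => ω ∈ openConn c z) := by
    refine Finset.filter_congr (fun z hz => ?_)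
    have hzu : z ≠ u := fun h => hu (h ▸ hz)
    exact pend huc.symm hzu
  have hfuv1 : (A.filter fun z => ω₁ ∈ openConn u z ∨ ω₁ ∈ openConn v z) = (A.filter fun z => ω ∈ openConn a' z) := by
    refine Finset.filter_congr (fun z hz => ?_)
    have hzu : z ≠ u := fun h => hu (h ▸ hz)
    have hzv : z ≠ v := fun h => hv (h ▸ hz)
    constructor
    · rintro (h | h)
      · exact ((ctr hzu).1 h.symm).symm
      · exact absurd h.symm (not_reachable_to_isolated ω₁ hzv hisoV₁)
    · intro h
      exact Or.inl ((ctr hzu).2 h.symm).symm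
  have e1 : ω ∈ (fun ω : BondConfig (Fin n) => insert s(u, a') ω) ⁻¹'
        {ω : BondConfig (Fin n) | ω ∉ openConn c u ∧ ω ∉ openConn c v ∧ (A.filter fun z => ω ∈ openConn c z).card ≤ j} ↔
      (¬ (openGraph ω).Reachable c a' ∧ (A.filter fun z => ω ∈ openConn c z).card ≤ j) := by
    constructor
    · intro h
      obtain ⟨h1, -, h3⟩ := h
      exact ⟨fun hr => h1 ((ctr huc.symm).2 hr), hfc1 ▸ h3⟩
    · rintro ⟨h1, h3⟩
      exact ⟨fun hr => h1 ((ctr huc.symm).1 hr), hcv1, hfc1.symm ▸ h3⟩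
  have e2 : ω ∈ (fun ω : BondConfig (Fin n) => insert s(u, a') ω) ⁻¹'
        {ω : BondConfig (Fin n) | ω ∉ openConn c u ∧ ω ∉ openConn c v ∧
          1 ≤ (A.filter fun z => ω ∈ openConn u z ∨ ω ∈ openConn v z).card ∧
          (A.filter fun z => ω ∈ openConn u z ∨ ω ∈ openConn v z).card ≤ j} ↔
      (¬ (openGraph ω).Reachable c a' ∧ (A.filter fun z => ω ∈ openConn a' z).card ≤ j) := by
    have ha'mem : a' ∈ (A.filter fun z => ω ∈ openConn a' z) :=
      Finset.mem_filter.2 ⟨ha', (SimpleGraph.Reachable.refl _ : (openGraph ω).Reachable a' a')⟩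
    have h1le : 1 ≤ (A.filter fun z => ω ∈ openConn a' z).card := Finset.card_pos.2 ⟨a', ha'mem⟩
    constructor
    · intro h
      obtain ⟨h1, -, -, h4⟩ := h
      exact ⟨fun hr => h1 ((ctr huc.symm).2 hr), hfuv1 ▸ h4⟩
    · rintro ⟨h1, h4⟩
      exact ⟨fun hr => h1 ((ctr huc.symm).1 hr), hcv1, hfuv1.symm ▸ h1le, hfuv1.symm ▸ h4⟩
  -- world PV
  set ω₂ : BondConfig (Fin n) := insert s(v, b) (insert s(v, b') ω) with hω₂
  have hisoU₂ : ∀ y : Fin n, y ≠ u → s(u, y) ∉ ω₂ := isolated_insert_hub ω huv hub hub' hisoU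
  set ω₃ : BondConfig (Fin n) := insert s(u, a') ω₂ with hω₃
  have pend3 : ∀ {p q : Fin n}, p ≠ u → q ≠ u → ((openGraph ω₃).Reachable p q ↔ (openGraph ω₂).Reachable p q) :=
    fun hp hq => reachable_pendant_iff ω₂ hua' hisoU₂ hp hq
  have ctr3 : ∀ {x : Fin n}, x ≠ u → ((openGraph ω₃).Reachable x u ↔ (openGraph ω₂).Reachable x a') :=
    fun hx => reachable_pendant_center_iff ω₂ hua' hisoU₂ hx
  have r2 : ∀ {x z : Fin n}, x ≠ v → z ≠ v → ((openGraph ω₂).Reachable x z ↔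
      ((openGraph ω).Reachable x z ∨ (((openGraph ω).Reachable x b ∨ (openGraph ω).Reachable x b') ∧
        ((openGraph ω).Reachable b z ∨ (openGraph ω).Reachable b' z)))) :=
    fun hx hz => reachable_hub_iff ω hvb hvb' hisoV hx hz
  have cv2 : ∀ {x : Fin n}, x ≠ v → ((openGraph ω₂).Reachable x v ↔
      ((openGraph ω).Reachable x b ∨ (openGraph ω).Reachable x b')) :=
    fun hx => reachable_hub_center_iff ω hvb hvb' hisoV hx
  have hfc3 : (A.filter fun z => ω₃ ∈ openConn c z) = (A.filter fun z => ω₂ ∈ openConn c z) := by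
    refine Finset.filter_congr (fun z hz => ?_)
    have hzu : z ≠ u := fun h => hu (h ▸ hz)
    exact pend3 huc.symm hzu
  have hsm2 : (A.filter fun z => ω₂ ∈ openConn c z).card ≤ j ↔
      (¬ ((openGraph ω).Reachable c b ∨ (openGraph ω).Reachable c b') ∧ (A.filter fun z => ω ∈ openConn c z).card ≤ j) :=
    small_hub_iff A ω j hj hv hb hb' hc hbb' hcb hcb' hisoV
  have e3 : ω ∈ (fun ω : BondConfig (Fin n) => insert s(u, a') (insert s(v, b) (insert s(v, b') ω))) ⁻¹'
        {ω : BondConfig (Fin n) | ω ∉ openConn c u ∧ ω ∉ openConn c v ∧ (A.filter fun z => ω ∈ openConn c z).card ≤ j} ↔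
      (¬ (openGraph ω).Reachable c a' ∧ ¬ (openGraph ω).Reachable c b ∧ ¬ (openGraph ω).Reachable c b' ∧
        (A.filter fun z => ω ∈ openConn c z).card ≤ j) := by
    have hvu : v ≠ u := huv.symm
    constructor
    · intro h
      obtain ⟨h1, h2, h3⟩ := h
      have hcv : ¬ ((openGraph ω).Reachable c b ∨ (openGraph ω).Reachable c b') :=
        fun hr => h2 ((pend3 huc.symm hvu).2 ((cv2 hvc.symm).2 hr))
      have h3' : (A.filter fun z => ω₂ ∈ openConn c z).card ≤ j := by rw [← hfc3]; exact h3
      refine ⟨fun hr => h1 ((ctr3 huc.symm).2 ((r2 hvc.symm hva'.symm).2 (Or.inl hr))),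
        fun hr => hcv (Or.inl hr), fun hr => hcv (Or.inr hr), (hsm2.1 h3').2⟩
    · rintro ⟨h1, hkb, hkb', hsc⟩
      refine ⟨fun hr => ?_, fun hr => ((cv2 hvc.symm).1 ((pend3 huc.symm hvu).1 hr)).elim hkb hkb', ?_⟩
      · have h' := (r2 hvc.symm hva'.symm).1 ((ctr3 huc.symm).1 hr)
        rcases h' with h' | ⟨h', _⟩
        · exact h1 h'
        · exact h'.elim hkb hkb'
      · show (A.filter fun z => ω₃ ∈ openConn c z).card ≤ j
        rw [hfc3]
        exact hsm2.2 ⟨fun hr => hr.elim hkb hkb', hsc⟩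
  have e4 : ω ∈ (fun ω : BondConfig (Fin n) => insert s(u, a') (insert s(v, b) (insert s(v, b') ω))) ⁻¹'
        {ω : BondConfig (Fin n) | ω ∉ openConn c u ∧ ω ∉ openConn c v ∧
          1 ≤ (A.filter fun z => ω ∈ openConn u z ∨ ω ∈ openConn v z).card ∧
          (A.filter fun z => ω ∈ openConn u z ∨ ω ∈ openConn v z).card ≤ j} ↔ False := by
    have hvu : v ≠ u := huv.symm
    constructor
    · intro h
      have h4 : (A.filter fun z => ω₃ ∈ openConn u z ∨ ω₃ ∈ openConn v z).card ≤ j := h.2.2.2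
      have hm : ∀ z : Fin n, z ∈ A → ((openGraph ω₃).Reachable u z ∨ (openGraph ω₃).Reachable v z) →
          z ∈ (A.filter fun z => ω₃ ∈ openConn u z ∨ ω₃ ∈ openConn v z) :=
        fun z hz h => Finset.mem_filter.2 ⟨hz, h⟩
      have hza' := hm a' ha' (Or.inl ((ctr3 hua'.symm).2 (SimpleGraph.Reachable.refl _)).symm)
      have hzb := hm b hb (Or.inr ((pend3 hvu hub.symm).2 ((cv2 hvb.symm).2 (Or.inl (SimpleGraph.Reachable.refl _))).symm))
      have hzb' := hm b' hb' (Or.inr ((pend3 hvu hub'.symm).2 ((cv2 hvb'.symm).2 (Or.inr (SimpleGraph.Reachable.refl _))).symm))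
      have h3 := three_le_card_of_mem hza' hzb hzb' ha'b ha'b' hbb'
      omega
    · exact False.elim
  exact ⟨e1, e2, e3, e4⟩

/-- Level-2 membership translations in world `W` (both hubs glued) for the loneliness events of `u`'s ports `a` and of
`v`'s port `b` only (no fifth vertex needed). [this file] -/
theorem iffs_w_ab (A : Finset (Fin n)) (ω : BondConfig (Fin n))
    (u v a a' b b' : Fin n) (j : ℕ) (hj : j ≤ 2) (hu : u ∉ A) (hv : v ∉ A) (huv : u ≠ v)
    (ha : a ∈ A) (ha' : a' ∈ A) (hb : b ∈ A) (hb' : b' ∈ A)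
    (haa' : a ≠ a') (hbb' : b ≠ b') (hab : a ≠ b) (hab' : a ≠ b') (ha'b : a' ≠ b) (ha'b' : a' ≠ b')
   
    (hisoU : ∀ y : Fin n, y ≠ u → s(u, y) ∉ ω) (hisoV : ∀ y : Fin n, y ≠ v → s(v, y) ∉ ω) :
    (ω ∈ (fun ω : BondConfig (Fin n) => insert s(u, a) (insert s(u, a') (insert s(v, b) (insert s(v, b') ω)))) ⁻¹' {ω : BondConfig (Fin n) | (A.filter fun z => ω ∈ openConn a z).card ≤ j} ↔ (((A.filter fun z => ω ∈ openConn a z) ∪ (A.filter fun z => ω ∈ openConn a' z)).card ≤ j)) ∧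
    (ω ∈ (fun ω : BondConfig (Fin n) => insert s(u, a) (insert s(u, a') (insert s(v, b) (insert s(v, b') ω)))) ⁻¹' {ω : BondConfig (Fin n) | (A.filter fun z => ω ∈ openConn b z).card ≤ j} ↔ (((A.filter fun z => ω ∈ openConn b z) ∪ (A.filter fun z => ω ∈ openConn b' z)).card ≤ j)) := by
  have hua : u ≠ a := fun h => hu (h ▸ ha)
  have hua' : u ≠ a' := fun h => hu (h ▸ ha')
  have hub : u ≠ b := fun h => hu (h ▸ hb)
  have hub' : u ≠ b' := fun h => hu (h ▸ hb')
  have hva : v ≠ a := fun h => hv (h ▸ ha)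
  have hva' : v ≠ a' := fun h => hv (h ▸ ha')
  have hvb : v ≠ b := fun h => hv (h ▸ hb)
  have hvb' : v ≠ b' := fun h => hv (h ▸ hb')
  set ω₂ : BondConfig (Fin n) := insert s(v, b) (insert s(v, b') ω) with hω₂
  have hisoU₂ : ∀ y : Fin n, y ≠ u → s(u, y) ∉ ω₂ := isolated_insert_hub ω huv hub hub' hisoU
  have r2 : ∀ {x z : Fin n}, x ≠ v → z ≠ v → ((openGraph ω₂).Reachable x z ↔
      ((openGraph ω).Reachable x z ∨ (((openGraph ω).Reachable x b ∨ (openGraph ω).Reachable x b') ∧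
        ((openGraph ω).Reachable b z ∨ (openGraph ω).Reachable b' z)))) :=
    fun hx hz => reachable_hub_iff ω hvb hvb' hisoV hx hz
  have eVb : ω ∈ (fun ω : BondConfig (Fin n) => insert s(v, b) (insert s(v, b') ω)) ⁻¹' {ω : BondConfig (Fin n) | (A.filter fun z => ω ∈ openConn b z).card ≤ j} ↔ (((A.filter fun z => ω ∈ openConn b z) ∪ (A.filter fun z => ω ∈ openConn b' z)).card ≤ j) := small_hub_self_iff A ω j hv hb hvb' hisoV
  have eWa : ω ∈ (fun ω : BondConfig (Fin n) => insert s(u, a) (insert s(u, a') (insert s(v, b) (insert s(v, b') ω)))) ⁻¹' {ω : BondConfig (Fin n) | (A.filter fun z => ω ∈ openConn a z).card ≤ j} ↔ (((A.filter fun z => ω ∈ openConn a z) ∪ (A.filter fun z => ω ∈ openConn a' z)).card ≤ j) := by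
    show (A.filter fun z => insert s(u, a) (insert s(u, a') ω₂) ∈ openConn a z).card ≤ j ↔ _
    rw [small_hub_self_iff A ω₂ j hu ha hua' hisoU₂]
    constructor
    · intro h
      refine le_trans (Finset.card_le_card (Finset.union_subset_union ?_ ?_)) h
      · intro z hz; rw [Finset.mem_filter] at hz ⊢
        exact ⟨hz.1, reachable_insert_of_reachable _ _ (reachable_insert_of_reachable _ _ hz.2)⟩
      · intro z hz; rw [Finset.mem_filter] at hz ⊢
        exact ⟨hz.1, reachable_insert_of_reachable _ _ (reachable_insert_of_reachable _ _ hz.2)⟩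
    · intro h
      have hna := not_reachable_of_small_pair A ω j hj ha ha' hb haa' hab.symm ha'b.symm h
      have hna' := not_reachable_of_small_pair A ω j hj ha ha' hb' haa' hab'.symm ha'b'.symm h
      have hfa : (A.filter fun z => ω₂ ∈ openConn a z) = (A.filter fun z => ω ∈ openConn a z) :=
        filter_hub_eq_of_not A ω hv hvb hvb' hva.symm hisoV (fun h' => hna.1 h'.symm) (fun h' => hna'.1 h'.symm)
      have hfa' : (A.filter fun z => ω₂ ∈ openConn a' z) = (A.filter fun z => ω ∈ openConn a' z) :=
        filter_hub_eq_of_not A ω hv hvb hvb' hva'.symm hisoV (fun h' => hna.2 h'.symm) (fun h' => hna'.2 h'.symm)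
      rw [hfa, hfa']; exact h
  have eWb : ω ∈ (fun ω : BondConfig (Fin n) => insert s(u, a) (insert s(u, a') (insert s(v, b) (insert s(v, b') ω)))) ⁻¹' {ω : BondConfig (Fin n) | (A.filter fun z => ω ∈ openConn b z).card ≤ j} ↔ (((A.filter fun z => ω ∈ openConn b z) ∪ (A.filter fun z => ω ∈ openConn b' z)).card ≤ j) := by
    show (A.filter fun z => insert s(u, a) (insert s(u, a') ω₂) ∈ openConn b z).card ≤ j ↔ _
    rw [small_hub_iff A ω₂ j hj hu ha ha' hb haa' hab.symm ha'b.symm hisoU₂]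
    have hb3 : (A.filter fun z => ω₂ ∈ openConn b z).card ≤ j ↔ (((A.filter fun z => ω ∈ openConn b z) ∪ (A.filter fun z => ω ∈ openConn b' z)).card ≤ j) := eVb
    rw [hb3]
    constructor
    · rintro ⟨-, h⟩; exact h
    · intro h
      refine ⟨?_, h⟩
      -- if b were attached to a (or a') in ω₂, then a (or a') would lie in π(b) ∪ π(b'), a set of size ≤ 2 = {b,b'}
      have hna : ¬ (openGraph ω).Reachable a b ∧ ¬ (openGraph ω).Reachable a b' :=
        not_reachable_of_small_pair A ω j hj hb hb' ha hbb' hab hab' h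
      have hna' : ¬ (openGraph ω).Reachable a' b ∧ ¬ (openGraph ω).Reachable a' b' :=
        not_reachable_of_small_pair A ω j hj hb hb' ha' hbb' ha'b ha'b' h
      rintro (hh | hh)
      · rcases (r2 hvb.symm hva.symm).1 hh with hh | ⟨-, hh | hh⟩
        · exact hna.1 hh.symm
        · exact hna.1 hh.symm
        · exact hna.2 hh.symm
      · rcases (r2 hvb.symm hva'.symm).1 hh with hh | ⟨-, hh | hh⟩
        · exact hna'.1 hh.symm
        · exact hna'.1 hh.symm
        · exact hna'.2 hh.symm
  exact ⟨eWa, eWb⟩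

/-- Level-2 translations in the pendant world `P0` for the observer events of `c` and of the hub `u`:
`R_c@P0 ↔ c lonely`, `L_u@P0 ↔ a' lonely`. [this file; memo §9 (T)] -/
theorem iffs_cport_pendant' (A : Finset (Fin n)) (ω : BondConfig (Fin n))
    (u c a' : Fin n) (j : ℕ) (hu : u ∉ A) (hc : c ∈ A) (ha' : a' ∈ A)
    (hisoU : ∀ y : Fin n, y ≠ u → s(u, y) ∉ ω) :
    (ω ∈ (fun ω : BondConfig (Fin n) => insert s(u, a') ω) ⁻¹'
        {ω : BondConfig (Fin n) | (A.filter fun z => ω ∈ openConn c z).card ≤ j} ↔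
      (A.filter fun z => ω ∈ openConn c z).card ≤ j) ∧
    (ω ∈ (fun ω : BondConfig (Fin n) => insert s(u, a') ω) ⁻¹'
        {ω : BondConfig (Fin n) | 1 ≤ (A.filter fun z => ω ∈ openConn u z).card ∧
          (A.filter fun z => ω ∈ openConn u z).card ≤ j} ↔
      (A.filter fun z => ω ∈ openConn a' z).card ≤ j) := by
  have hua' : u ≠ a' := fun h => hu (h ▸ ha')
  have huc : u ≠ c := fun h => hu (h ▸ hc)
  set ω₁ : BondConfig (Fin n) := insert s(u, a') ω with hω₁
  have pend : ∀ {p q : Fin n}, p ≠ u → q ≠ u → ((openGraph ω₁).Reachable p q ↔ (openGraph ω).Reachable p q) :=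
    fun hp hq => reachable_pendant_iff ω hua' hisoU hp hq
  have ctr : ∀ {x : Fin n}, x ≠ u → ((openGraph ω₁).Reachable x u ↔ (openGraph ω).Reachable x a') :=
    fun hx => reachable_pendant_center_iff ω hua' hisoU hx
  have hfc1 : (A.filter fun z => ω₁ ∈ openConn c z) = (A.filter fun z => ω ∈ openConn c z) := by
    refine Finset.filter_congr (fun z hz => ?_)
    have hzu : z ≠ u := fun h => hu (h ▸ hz)
    exact pend huc.symm hzu
  have hfu1 : (A.filter fun z => ω₁ ∈ openConn u z) = (A.filter fun z => ω ∈ openConn a' z) := by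
    refine Finset.filter_congr (fun z hz => ?_)
    have hzu : z ≠ u := fun h => hu (h ▸ hz)
    constructor
    · intro h
      exact ((ctr hzu).1 h.symm).symm
    · intro h
      exact ((ctr hzu).2 h.symm).symm
  have ha'mem : a' ∈ (A.filter fun z => ω ∈ openConn a' z) :=
    Finset.mem_filter.2 ⟨ha', (SimpleGraph.Reachable.refl _ : (openGraph ω).Reachable a' a')⟩
  have h1le : 1 ≤ (A.filter fun z => ω ∈ openConn a' z).card := Finset.card_pos.2 ⟨a', ha'mem⟩
  refine ⟨?_, ?_⟩
  · show (A.filter fun z => ω₁ ∈ openConn c z).card ≤ j ↔ _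
    rw [hfc1]
  · show (1 ≤ (A.filter fun z => ω₁ ∈ openConn u z).card ∧ (A.filter fun z => ω₁ ∈ openConn u z).card ≤ j) ↔ _
    rw [hfu1]
    exact ⟨fun h => h.2, fun h => ⟨h1le, h⟩⟩

end TwoPortPeeling

end Summit.CriticalPhenomena.PercolationContinuityZ3.Theorems
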